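import Summits.AtomisticToContinuum.BoseEinsteinCondensation.Theorems.BECInsertionCorrectorCorrectorClosureSplit
import Summits.AtomisticToContinuum.BoseEinsteinCondensation.Statement
import HarnessLib

/-!
# Strategy census s8 — typed signatures for crux `CorrectorClosure` (item stmt-AtomisticToContinuum-12058)

Census family `s` (weaker intermediate → decomposition → sibling transfer). This file only TYPES the
statements discussed in `STRATEGY-CENSUS-s8.md` and proves the elementary implications between them and
the route's decls; it contains no `sorry` and proposes nothing. It is evidence, not a line.

* `PeriodicBECBody`   — item stmt-AtomisticToContinuum-8997 verbatim (torus BEC of near-minimisers).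
* `WeakIntermediate`  — `StaticResponseBound → PeriodicBECBody`: the unique minimal content any proof of the
                         crux must deliver (kernel-checked necessary, `weakIntermediate_of_correctorClosure`),
                         and already sufficient for the ROUTE's conclusion (`closes_reglued`).
* `InsertionResidueOfBEC` — child 2 of p169803 (removal fidelity given torus BEC, under K1).
* `correctorClosure_iff` — EXACT split with no side hypothesis: `CorrectorClosure ↔ WeakIntermediate ∧
                         InsertionResidueOfBEC` (p169803's iff needs `hK1` because its child 1 is unconditional).
* `MesoBEC κ` / `ScaleGluing κ` — the scale split: BEC on tori holding `N ≤ (ρ a³)^{-κ}` particles (in print for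
                         κ slightly above 1/2: Fournais 2021, Adhikari–Brennecke–Schlein 2021) and the gluing
                         step, which is the crux reworded (`scaleGluing_iff`).
-/

open MeasureTheory Filter Matrix
open scoped ENNReal NNReal BigOperators ComplexConjugate

namespace Summit.AtomisticToContinuum.BoseEinsteinCondensation.Cruxes.CorrectorClosure.CensusS8

open Literature.MathematicalPhysics.QuantumManyBody.BoseGas
open Summit.AtomisticToContinuum.BoseEinsteinCondensation.Theses.BECInsertionCorrector
open Summit.AtomisticToContinuum.BoseEinsteinCondensation.Theorems.CorrectorClosure.Split

/-- Torus BEC of near-minimisers at one admissible potential `v` (the body of item 8997 at `v`). -/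
def PeriodicBECAt (v : ℝ → ℝ≥0∞) : Prop :=
  ∃ ρ₀ : ℝ, 0 < ρ₀ ∧ ∀ ρ : ℝ, 0 < ρ → ρ < ρ₀ → ∃ c : ℝ, 0 < c ∧ ∀ᶠ N : ℕ in Filter.atTop,
    ∃ δ : ℝ≥0∞, 0 < δ ∧ ∀ Ψ : PeriodicTrialState N (sideLength ρ N),
      periodicEnergy v Ψ ≤ periodicGroundStateEnergy v N (sideLength ρ N) + δ →
      ENNReal.ofReal (c * N) ≤ condensateOccupation N (sideLength ρ N) Ψ.ψ

/-- Item stmt-AtomisticToContinuum-8997 verbatim: torus BEC for every repulsive finite-range `v`. -/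
def PeriodicBECBody : Prop :=
  ∀ v : ℝ → ℝ≥0∞, IsRepulsiveFiniteRange v → PeriodicBECAt v

/-- Insertion-residue floor at one admissible `v` (the body of the target `InsertionResidue` at `v`). -/
def InsertionResidueAt (v : ℝ → ℝ≥0∞) : Prop :=
  ∃ ρ₀ : ℝ, 0 < ρ₀ ∧ ∀ ρ : ℝ, 0 < ρ → ρ < ρ₀ → ∃ c : ℝ, 0 < c ∧ ∀ᶠ N : ℕ in Filter.atTop,
    ∃ δ : ℝ≥0∞, 0 < δ ∧ ∃ Θ : PeriodicTrialState N (sideLength ρ (N + 1)),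
      periodicEnergy v Θ ≤ periodicGroundStateEnergy v N (sideLength ρ (N + 1)) + δ ∧
      ∀ Ψ : PeriodicTrialState (N + 1) (sideLength ρ (N + 1)),
        periodicEnergy v Ψ ≤ periodicGroundStateEnergy v (N + 1) (sideLength ρ (N + 1)) + δ →
        ENNReal.ofReal c ≤ ENNReal.ofReal ((sideLength ρ (N + 1) ^ 3)⁻¹) *
          (‖∫ X in cellN N (sideLength ρ (N + 1)), conj (Θ.ψ X) *
              ∫ x in cell (sideLength ρ (N + 1)), Ψ.ψ (vecCons x X)‖₊ : ℝ≥0∞) ^ 2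

/-- **s-family weaker intermediate.** `W := K1 → torus BEC`. -/
def WeakIntermediate : Prop := StaticResponseBound → PeriodicBECBody

/-- Child 2 of the landed split p169803: under K1, torus BEC at `v` gives the insertion residue at `v`. -/
def InsertionResidueOfBEC : Prop :=
  StaticResponseBound → ∀ v : ℝ → ℝ≥0∞, IsRepulsiveFiniteRange v → PeriodicBECAt v → InsertionResidueAt v

/-- The target unfolds to the per-`v` residue (definitional). -/
theorem insertionResidue_iff : InsertionResidue ↔ ∀ v : ℝ → ℝ≥0∞, IsRepulsiveFiniteRange v →
    InsertionResidueAt v := Iff.rfl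

/-- `W` is NECESSARY: any proof of the crux proves `K1 → torus BEC` (p121285 / `ResidueCondenses_proof`). -/
theorem weakIntermediate_of_correctorClosure (hCC : CorrectorClosure) : WeakIntermediate :=
  fun hK1 => Summit.AtomisticToContinuum.BoseEinsteinCondensation.Theorems.ResidueCondenses_proof (hCC hK1)

/-- `W` already suffices for the ROUTE's conclusion through the route's own open items K1 and
`BoundaryTransferWeak` — the re-glue a tenure planner could apply (`closes` minus removal fidelity). -/
theorem closes_reglued (h₁ : StaticResponseBound) (hW : WeakIntermediate) (h₄ : BoundaryTransferWeak) :
    _root_.BoseEinsteinCondensation :=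
  fun v hv => h₄ v hv (hW h₁ v hv)

/-- Child 2 is NECESSARY (discard the BEC hypothesis). -/
theorem insertionResidueOfBEC_of_correctorClosure' (hCC : CorrectorClosure) : InsertionResidueOfBEC :=
  fun hK1 v hv _ => hCC hK1 v hv

/-- **Exact two-piece split with no side hypothesis**: the crux is literally `W ∧ child 2`. -/
theorem correctorClosure_iff : CorrectorClosure ↔ WeakIntermediate ∧ InsertionResidueOfBEC :=
  ⟨fun hCC => ⟨weakIntermediate_of_correctorClosure hCC, insertionResidueOfBEC_of_correctorClosure' hCC⟩,
    fun h hK1 v hv => h.2 hK1 v hv (h.1 hK1 v hv)⟩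

/-- The same split fed to the landed glue `CorrectorClosure_of_subs` when child 1 is unconditional. -/
theorem correctorClosure_of_periodicBECBody (hP : PeriodicBECBody) (hB : InsertionResidueOfBEC) :
    CorrectorClosure :=
  CorrectorClosure_of_subs hP hB

/-- **Scale split, lower piece.** Torus BEC of near-minimisers for particle numbers up to `(ρ a³)^{-κ}`
(`a` = scattering length): for `κ` slightly above `1/2` this is the beyond-Gross–Pitaevskii regime where BEC
is a theorem in print (Fournais 2021 Thm 1.2; Adhikari–Brennecke–Schlein 2021); `κ = ∞` is item 8997. -/
def MesoBEC (κ : ℝ) : Prop :=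
  ∀ v : ℝ → ℝ≥0∞, IsRepulsiveFiniteRange v → ∃ ρ₀ : ℝ, 0 < ρ₀ ∧ ∀ ρ : ℝ, 0 < ρ → ρ < ρ₀ →
    ∃ c : ℝ, 0 < c ∧ ∃ N₀ : ℕ, ∀ N : ℕ, N₀ ≤ N →
      (N : ℝ) ≤ (ρ * (scatteringLength v).toReal ^ 3) ^ (-κ) →
      ∃ δ : ℝ≥0∞, 0 < δ ∧ ∀ Ψ : PeriodicTrialState N (sideLength ρ N),
        periodicEnergy v Ψ ≤ periodicGroundStateEnergy v N (sideLength ρ N) + δ →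
        ENNReal.ofReal (c * N) ≤ condensateOccupation N (sideLength ρ N) Ψ.ψ

/-- **Scale split, upper piece (the gluing).** From K1 and mesoscopic BEC to thermodynamic torus BEC. -/
def ScaleGluing (κ : ℝ) : Prop := StaticResponseBound → MesoBEC κ → PeriodicBECBody

/-- The scale split assembles to `W` … -/
theorem weakIntermediate_of_scaleSplit {κ : ℝ} (hM : MesoBEC κ) (hG : ScaleGluing κ) :
    WeakIntermediate := fun hK1 => hG hK1 hM

/-- … and, once the lower piece is a theorem, the gluing piece IS `W`: the split moves no difficulty. -/
theorem scaleGluing_iff {κ : ℝ} (hM : MesoBEC κ) : ScaleGluing κ ↔ WeakIntermediate :=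
  ⟨fun hG hK1 => hG hK1 hM, fun hW hK1 _ => hW hK1⟩

/-- **Strengthening audit.** Dropping K1 from `W` gives item 8997 itself; it trivially implies `W`. -/
theorem weakIntermediate_of_periodicBECBody (hP : PeriodicBECBody) : WeakIntermediate := fun _ => hP

end Summit.AtomisticToContinuum.BoseEinsteinCondensation.Cruxes.CorrectorClosure.CensusS8
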